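import Mathlib
import HarnessLib
import Literature.Computability.AlgebraicComplexity.ArithCircuit
import Literature.Computability.AlgebraicComplexity.SupportSymmetrisation
import Summits.ValiantsHypothesis.ValiantsHypothesis.Theorems.MonotoneRestorationMonotoneRestorationQPRowScanGates
import Summits.ValiantsHypothesis.ValiantsHypothesis.Theorems.MonotoneRestorationMonotoneRestorationQPCommutingMatricesNewton
import Summits.ValiantsHypothesis.ValiantsHypothesis.Theorems.MonotoneRestorationMonotoneRestorationQPBlockGadgets

/-!
# ValiantsHypothesis / MonotoneRestoration — `MonotoneRestorationQP`, block-monomial gadgets (2/2)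

Support file for crux item `stmt-ValiantsHypothesis-15886`
(`Summit.ValiantsHypothesis.ValiantsHypothesis.Theses.MonotoneRestoration.MonotoneRestorationQP`),
stub `stub_monotoneSupportReduction` in its quasi-polynomially SPARSE regime (TTRL-lite variant
V20164, file `…QPVariants20164.lean`): the NESTED NEWTON gadget computing a BLOCK MONOMIAL by a
supported straight-line program of small support width.

A block monomial `x^a` on the `n × n` variable matrix has special rows `S` and special columns
`T`: its exponent matrix `a` is constant down each column outside `S` and along each row outside
`T` (the shape of every monomial of a sparse matrix-symmetric polynomial,
`…QPSparseBlockStructure.lean`). It is located at support `S ∪ T` by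

* `blockGadgets_opPow` — a power `u ^ d` of one operand (one hereditary product gate);
* `blockGadgets_rowProduct` — the row products `R_i = ∏_j x_{ij}^{a_{ij}}` at supports
  `insert i T`: power sums `Σ_j x_{ij}^{a_{ij}(k+1)}` of the family `(x_{ij}^{a_{ij}})_j` (which a
  permutation fixing `insert i T` pointwise permutes) and Newton's recursion;
* `blockGadgets_monomial` — the power sums `Σ_i R_i^{k+1}` at support `S ∪ T` (a permutation
  fixing `S ∪ T` pointwise carries `R_i` to `R_{σ i}`) and Newton's recursion once more:
  `e_n(R_0, …, R_{n-1}) = ∏_i R_i = x^a`; at most `3 (n + 1)³` gates of width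
  `≤ max (|S ∪ T| + 1) 2`.

Newton's identities enter through the tree's
`CommutingMatricesNewton.natCast_mul_esymm_eq_sum_range` and `NewtonProdPsum.esymm_self_eq_prod_X`.

## References

* I. G. Macdonald, *Symmetric Functions and Hall Polynomials*, 2nd ed., OUP 1995, I.(2.11')
  (Newton's identities).
* P. Bürgisser, *Completeness and Reduction in Algebraic Complexity Theory*, Springer 2000,
  Def. 2.1 (straight-line programs).
-/

-- `Summit.ValiantsHypothesis.ValiantsHypothesis.…` is the tree's mandated single-conjunct layout
-- (Sub = Summit), so the duplicated namespace component is intended.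
set_option linter.dupNamespace false

open Literature.Computability.AlgebraicComplexity MvPolynomial

namespace Summit.ValiantsHypothesis.ValiantsHypothesis.Theorems

/-! ### Block monomials -/

section Blocks

variable {n : ℕ} (A w : ℕ)
  (Inv : List (ArithCircuit.Gate ℂ (Fin n × Fin n)) → (ℕ → Finset (Fin n)) → Prop)
  (hcore : ∀ (L : List (ArithCircuit.Gate ℂ (Fin n × Fin n))) (K : ℕ → Finset (Fin n))
    (g : ArithCircuit.Gate ℂ (Fin n × Fin n)) (S : Finset (Fin n)), Inv L K → g.args ≠ [] →
    g.fanIn ≤ A → (∀ u ∈ g.args, u.RefsBelow L.length) → S.card ≤ w →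
    (∀ us, g = .prod us → ∀ u ∈ us, SupportSymm.osupp K u ⊆ S) →
    (∀ σ : Equiv.Perm (Fin n), (∀ x ∈ S, σ x = x) →
      rename (fun pq : Fin n × Fin n => (σ pq.1, σ pq.2)) (g.eval (ArithCircuit.gateValues L)) =
        g.eval (ArithCircuit.gateValues L)) →
    Inv (L ++ [g]) (Function.update K L.length S))
  (hhered : ∀ (L : List (ArithCircuit.Gate ℂ (Fin n × Fin n))) (K : ℕ → Finset (Fin n))
    (g : ArithCircuit.Gate ℂ (Fin n × Fin n)) (S : Finset (Fin n)), Inv L K → g.args ≠ [] →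
    g.fanIn ≤ A → (∀ u ∈ g.args, u.RefsBelow L.length) → S.card ≤ w →
    (∀ u ∈ g.args, SupportSymm.osupp K u ⊆ S) → Inv (L ++ [g]) (Function.update K L.length S))

include hhered in
/-- **A power of one operand.** For an operand `o` referring to an earlier gate and supported
inside `S₀` (`|S₀| ≤ w`), one hereditary product gate `1 · o ⋯ o` (fan-in `d + 1`) locates
`o ^ d` at support `S₀`. [folklore] -/
theorem blockGadgets_opPow (S₀ : Finset (Fin n)) (hS₀ : S₀.card ≤ w)
    (o : ArithCircuit.Operand ℂ (Fin n × Fin n)) (d : ℕ) (hAd : d + 1 ≤ A)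
    (L : List (ArithCircuit.Gate ℂ (Fin n × Fin n))) (K : ℕ → Finset (Fin n))
    (ho : o.RefsBelow L.length) (hoS : SupportSymm.osupp K o ⊆ S₀) (hInv : Inv L K) :
    ∃ (L' : List (ArithCircuit.Gate ℂ (Fin n × Fin n))) (K' : ℕ → Finset (Fin n)), L <+: L' ∧
      (∀ t < L.length, K' t = K t) ∧ L'.length ≤ L.length + 1 ∧ Inv L' K' ∧
      ∃ t < L'.length, K' t = S₀ ∧
        (ArithCircuit.gateValues L').getD t 0 = (o.eval (ArithCircuit.gateValues L)) ^ d := by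
  obtain ⟨hp, ha, hl, hlt, hK, hv⟩ := rowScanGates_append L K
    (.prod (.const 1 :: List.replicate d o)) S₀
  refine ⟨_, _, hp, ha, hl, hhered L K _ _ hInv (by simp [ArithCircuit.Gate.args]) ?_ ?_ hS₀ ?_,
    L.length, hlt, hK, ?_⟩
  · simpa [ArithCircuit.Gate.fanIn, ArithCircuit.Gate.args] using hAd
  · intro u hu
    rcases List.mem_cons.1 hu with rfl | hu
    · trivial
    · rw [List.eq_of_mem_replicate hu]
      exact ho
  · intro u hu
    rcases List.mem_cons.1 hu with rfl | hu
    · simp [SupportSymm.osupp]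
    · rw [List.eq_of_mem_replicate hu]
      exact hoS
  · rw [hv]
    simp [ArithCircuit.Gate.eval, ArithCircuit.Operand.eval, List.map_replicate,
      List.prod_replicate]

include hcore hhered in
/-- **Row products.** If row `i` of the exponent matrix `a` (entries `≤ D`) is constant outside
the columns `T`, then from `(L, K)` satisfying `Inv` at most `2 (n + 1)²` more gates locate the
row product `R_i = ∏_j x_{ij}^{a_{ij}}` at support `insert i T` (`|insert i T| ≤ w`, `2 ≤ w`):
the power sums `Σ_j x_{ij}^{a_{ij} (k+1)}`, `k < n`, of the family `(x_{ij}^{a_{ij}})_j` (product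
gates at supports `{i, j}` and one equivariant sum each — a permutation fixing `insert i T`
pointwise permutes the family because it preserves the exponents), followed by Newton's
recursion (`blockGadgets_newton`, `E_k = e_k(x_{i0}^{a_{i0}}, …)`, `E_n = R_i`).
[cite: Macdonald1995, I.(2.11')] -/
theorem blockGadgets_rowProduct (D : ℕ) (hAn : n + 2 ≤ A) (hAD : D * n + 1 ≤ A) (hw : 2 ≤ w)
    (a : (Fin n × Fin n) →₀ ℕ) (hdeg : ∀ p, a p ≤ D) (T : Finset (Fin n)) (i : Fin n)
    (hT : (insert i T).card ≤ w)
    (hcols : ∀ j j' : Fin n, j ∉ T → j' ∉ T → a (i, j) = a (i, j'))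
    (L : List (ArithCircuit.Gate ℂ (Fin n × Fin n))) (K : ℕ → Finset (Fin n)) (hInv : Inv L K) :
    ∃ (L' : List (ArithCircuit.Gate ℂ (Fin n × Fin n))) (K' : ℕ → Finset (Fin n)), L <+: L' ∧
      (∀ t < L.length, K' t = K t) ∧ L'.length ≤ L.length + 2 * (n + 1) * (n + 1) ∧ Inv L' K' ∧
      ∃ t < L'.length, K' t = insert i T ∧
        (ArithCircuit.gateValues L').getD t 0 =
          ∏ j : Fin n, (X (i, j) : MvPolynomial (Fin n × Fin n) ℂ) ^ a (i, j) := by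
  -- Step 1: the power sums `Σ_j x_{ij}^{a_{ij} (k+1)}`, `k < n`, at support `insert i T`
  obtain ⟨L₁, K₁, hpre₁, hagr₁, hlen₁, hInv₁, hps⟩ := rowScanGates_iter (ι := Fin n) (β := Unit)
    Inv (fun _ _ => insert i T)
    (fun k _ => ∑ j : Fin n,
      (X (i, j) : MvPolynomial (Fin n × Fin n) ℂ) ^ (a (i, j) * ((k : ℕ) + 1)))
    (n + 1) L K
    (fun k L' K' _ _ hInv' => by
      -- the powers `x_{ij}^{a_{ij} (k+1)}`, one product gate each, at supports `{i, j}`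
      obtain ⟨L₂, K₂, hpre₂, hagr₂, hlen₂, hInv₂, hpow⟩ := rowScanGates_iter (ι := Fin n)
        (β := Unit) Inv (fun j _ => ({i, j} : Finset (Fin n)))
        (fun j _ => (X (i, j) : MvPolynomial (Fin n × Fin n) ℂ) ^ (a (i, j) * ((k : ℕ) + 1)))
        1 L' K'
        (fun j L'' K'' _ _ hInv'' => by
          have hfan : a (i, j) * ((k : ℕ) + 1) + 1 ≤ A := by
            have h1 : a (i, j) * ((k : ℕ) + 1) ≤ D * n := Nat.mul_le_mul (hdeg _) k.2
            omega
          obtain ⟨L₃, K₃, hp, ha, hl, hI, t, ht, hK, hv⟩ := blockGadgets_opPow A w Inv hhered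
            ({i, j} : Finset (Fin n)) (Finset.card_le_two.trans hw) (.var (i, j))
            (a (i, j) * ((k : ℕ) + 1)) hfan L'' K'' trivial (by simp [SupportSymm.osupp]) hInv''
          refine ⟨L₃, K₃, hp, ha, hl, hI, fun _ => ⟨t, ht, hK, ?_⟩⟩
          rw [hv]
          rfl)
        hInv'
      choose tab htab using fun j => hpow j ()
      have hequiv : ∀ σ : Equiv.Perm (Fin n), (∀ x ∈ insert i T, σ x = x) → ∀ j : Fin n,
          rename (fun pq : Fin n × Fin n => (σ pq.1, σ pq.2))
            ((X (i, j) : MvPolynomial (Fin n × Fin n) ℂ) ^ (a (i, j) * ((k : ℕ) + 1))) =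
            (X (i, σ j) : MvPolynomial (Fin n × Fin n) ℂ) ^ (a (i, σ j) * ((k : ℕ) + 1)) := by
        intro σ hσ j
        have hσi : σ i = i := hσ i (Finset.mem_insert_self i T)
        have haj : a (i, j) = a (i, σ j) := by
          by_cases hj : j ∈ T
          · rw [hσ j (Finset.mem_insert_of_mem hj)]
          · refine hcols j (σ j) hj fun hσj => hj ?_
            have hfix : σ (σ j) = σ j := hσ (σ j) (Finset.mem_insert_of_mem hσj)
            have hj' : σ j = j := σ.injective hfix
            rwa [hj'] at hσj
        simp only [map_pow, rename_X, hσi]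
        rw [haj]
      obtain ⟨L₃, K₃, hp, ha, hl, hI, t, ht, hK, hv⟩ := blockGadgets_equivSum A w Inv hcore
        (by omega) (insert i T) hT
        (fun j => (X (i, j) : MvPolynomial (Fin n × Fin n) ℂ) ^ (a (i, j) * ((k : ℕ) + 1)))
        hequiv L₂ K₂ tab (fun j => ⟨(htab j).1, (htab j).2.2⟩) hInv₂
      refine ⟨L₃, K₃, hpre₂.trans hp, fun t ht => ?_, ?_, hI, fun _ => ⟨t, ht, hK, hv⟩⟩
      · rw [ha t (lt_of_lt_of_le ht hpre₂.length_le), hagr₂ t ht]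
      · rw [Fintype.card_fin] at hlen₂
        omega)
    hInv
  choose ps hps' using fun k : Fin n => hps k ()
  -- Step 2: Newton's recursion at support `insert i T`
  obtain ⟨y, hy⟩ : ∃ y : Fin n → MvPolynomial (Fin n × Fin n) ℂ,
      ∀ j, y j = X (i, j) ^ a (i, j) := ⟨_, fun _ => rfl⟩
  have hpsum : ∀ k : ℕ, aeval y (psum (Fin n) ℂ (k + 1)) =
      ∑ j : Fin n, (X (i, j) : MvPolynomial (Fin n × Fin n) ℂ) ^ (a (i, j) * (k + 1)) := by
    intro k
    simp only [psum, map_sum, map_pow, aeval_X, hy, ← pow_mul]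
  have key := blockGadgets_newton A w Inv hhered n hAn (insert i T) hT
    (fun k => aeval y (esymm (Fin n) ℂ k))
    (fun k => ∑ j : Fin n, (X (i, j) : MvPolynomial (Fin n × Fin n) ℂ) ^ (a (i, j) * (k + 1)))
    (by simp) ?_ L₁ K₁ (fun k => if h : k < n then ps ⟨k, h⟩ else 0) ?_ hInv₁
  · obtain ⟨L', K', hpre, hagr, hlen, hInv', t, ht, hK, hv⟩ := key
    refine ⟨L', K', hpre₁.trans hpre, fun t ht => ?_, ?_, hInv', t, ht, hK, ?_⟩
    · rw [hagr t (lt_of_lt_of_le ht hpre₁.length_le), hagr₁ t ht]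
    · rw [Fintype.card_fin] at hlen₁
      nlinarith [hlen, hlen₁]
    · rw [hv, NewtonProdPsum.esymm_self_eq_prod_X, map_prod]
      exact Finset.prod_congr rfl fun j _ => by rw [aeval_X, hy]
  · -- Newton's identities pushed through `aeval y`
    intro k _
    have h := congrArg (aeval y)
      (CommutingMatricesNewton.natCast_mul_esymm_eq_sum_range (Fin n) ℂ k)
    rw [map_mul, map_natCast, map_sum] at h
    rw [h]
    refine Finset.sum_congr rfl fun i' _ => ?_
    rw [map_mul, map_mul, map_pow, map_neg, map_one, hpsum]
  · -- the located power sums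
    intro k hk
    have h := hps' ⟨k, hk⟩
    simp only [dif_pos hk]
    exact h

include hcore hhered in
/-- **Block monomials.** If the exponent matrix `a` (entries `≤ D`) is constant down each column
outside the rows `S` and along each row outside the columns `T` (`|S ∪ T| + 1 ≤ w`, `2 ≤ w`),
then from `(L, K)` satisfying `Inv` at most `3 (n + 1)³` more gates locate the monomial
`x^a = ∏_i R_i` at support `S ∪ T`: the row products `R_i` (`blockGadgets_rowProduct`, support
`insert i T`), the power sums `Σ_i R_i^{k+1}` (powers at supports `insert i (S ∪ T)`, one
equivariant sum at support `S ∪ T` each — a permutation fixing `S ∪ T` pointwise carries `R_i` to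
`R_{σ i}`), and Newton's recursion at support `S ∪ T` (`E_n = ∏_i R_i = x^a`); the NESTED
Newton iteration of the sparse regime. [cite: Macdonald1995, I.(2.11')] -/
theorem blockGadgets_monomial (D : ℕ) (hAn : n + 2 ≤ A) (hAD : D * n + 1 ≤ A) (hw : 2 ≤ w)
    (a : (Fin n × Fin n) →₀ ℕ) (hdeg : ∀ p, a p ≤ D) (S T : Finset (Fin n))
    (hST : (S ∪ T).card + 1 ≤ w)
    (hrows : ∀ i i' j : Fin n, i ∉ S → i' ∉ S → a (i, j) = a (i', j))
    (hcols : ∀ i j j' : Fin n, j ∉ T → j' ∉ T → a (i, j) = a (i, j'))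
    (L : List (ArithCircuit.Gate ℂ (Fin n × Fin n))) (K : ℕ → Finset (Fin n)) (hInv : Inv L K) :
    ∃ (L' : List (ArithCircuit.Gate ℂ (Fin n × Fin n))) (K' : ℕ → Finset (Fin n)), L <+: L' ∧
      (∀ t < L.length, K' t = K t) ∧ L'.length ≤ L.length + 3 * (n + 1) ^ 3 ∧ Inv L' K' ∧
      ∃ t < L'.length, K' t = S ∪ T ∧ (ArithCircuit.gateValues L').getD t 0 = monomial a 1 := by
  -- the row products `R i = ∏_j x_{ij}^{a_{ij}}`
  obtain ⟨R, hR⟩ : ∃ R : Fin n → MvPolynomial (Fin n × Fin n) ℂ,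
      ∀ i, R i = ∏ j : Fin n, (X (i, j) : MvPolynomial (Fin n × Fin n) ℂ) ^ a (i, j) :=
    ⟨_, fun _ => rfl⟩
  have hTw : T.card + 1 ≤ w :=
    le_trans (Nat.succ_le_succ (Finset.card_le_card Finset.subset_union_right)) hST
  have hinsT : ∀ i, (insert i T).card ≤ w := fun i => (Finset.card_insert_le i T).trans hTw
  have hinsST : ∀ i, (insert i (S ∪ T)).card ≤ w := fun i =>
    (Finset.card_insert_le i (S ∪ T)).trans hST
  have hSTw : (S ∪ T).card ≤ w := (Nat.le_succ _).trans hST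
  -- Step 1: locate every row product at support `insert i T`
  obtain ⟨L₁, K₁, hpre₁, hagr₁, hlen₁, hInv₁, hrow⟩ := rowScanGates_iter (ι := Fin n) (β := Unit)
    Inv (fun i _ => insert i T) (fun i _ => R i) (2 * (n + 1) * (n + 1)) L K
    (fun i L' K' _ _ hInv' => by
      obtain ⟨L'', K'', hp, ha, hl, hI, t, ht, hK, hv⟩ := blockGadgets_rowProduct A w Inv hcore
        hhered D hAn hAD hw a hdeg T i (hinsT i) (hcols i) L' K' hInv'
      exact ⟨L'', K'', hp, ha, hl, hI, fun _ => ⟨t, ht, hK, by rw [hv, hR]⟩⟩)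
    hInv
  choose tr htr using fun i => hrow i ()
  -- equivariance of the row products under the permutations fixing `S ∪ T` pointwise
  have hequiv : ∀ σ : Equiv.Perm (Fin n), (∀ x ∈ S ∪ T, σ x = x) → ∀ i,
      rename (fun pq : Fin n × Fin n => (σ pq.1, σ pq.2)) (R i) = R (σ i) := by
    intro σ hσ i
    have hfixT : ∀ j, j ∈ T → σ j = j := fun j hj => hσ j (Finset.mem_union_right S hj)
    have hfixS : ∀ i, i ∈ S → σ i = i := fun i hi => hσ i (Finset.mem_union_left T hi)
    have ha : ∀ j, a (i, j) = a (σ i, σ j) := by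
      intro j
      have h1 : a (i, j) = a (σ i, j) := by
        by_cases hi : i ∈ S
        · rw [hfixS i hi]
        · refine hrows i (σ i) j hi fun hσi => hi ?_
          have hfix : σ (σ i) = σ i := hfixS (σ i) hσi
          have hi' : σ i = i := σ.injective hfix
          rwa [hi'] at hσi
      have h2 : a (σ i, j) = a (σ i, σ j) := by
        by_cases hj : j ∈ T
        · rw [hfixT j hj]
        · refine hcols (σ i) j (σ j) hj fun hσj => hj ?_
          have hfix : σ (σ j) = σ j := hfixT (σ j) hσj
          have hj' : σ j = j := σ.injective hfix
          rwa [hj'] at hσj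
      exact h1.trans h2
    rw [hR, hR, map_prod]
    simp only [map_pow, rename_X]
    calc ∏ j : Fin n, (X (σ i, σ j) : MvPolynomial (Fin n × Fin n) ℂ) ^ a (i, j)
        = ∏ j : Fin n, (X (σ i, σ j) : MvPolynomial (Fin n × Fin n) ℂ) ^ a (σ i, σ j) :=
          Finset.prod_congr rfl fun j _ => by rw [ha j]
      _ = ∏ j : Fin n, (X (σ i, j) : MvPolynomial (Fin n × Fin n) ℂ) ^ a (σ i, j) :=
          Equiv.prod_comp σ (fun j => (X (σ i, j) : MvPolynomial (Fin n × Fin n) ℂ) ^ a (σ i, j))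
  -- Step 2: the power sums `Σ_i R_i^{k+1}`, `k < n`, at support `S ∪ T`
  obtain ⟨L₂, K₂, hpre₂, hagr₂, hlen₂, hInv₂, hps⟩ := rowScanGates_iter (ι := Fin n) (β := Unit)
    Inv (fun _ _ => S ∪ T) (fun k _ => ∑ i : Fin n, R i ^ ((k : ℕ) + 1)) (n + 1) L₁ K₁
    (fun k L' K' hpre' hagr' hInv' => by
      -- the powers `R_i^{k+1}` at supports `insert i (S ∪ T)`, one product gate each
      obtain ⟨L₃, K₃, hpre₃, hagr₃, hlen₃, hInv₃, hpow⟩ := rowScanGates_iter (ι := Fin n)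
        (β := Unit) Inv (fun i _ => insert i (S ∪ T)) (fun i _ => R i ^ ((k : ℕ) + 1)) 1 L' K'
        (fun i L'' K'' hpre'' hagr'' hInv'' => by
          have h1 : tr i < L''.length := lt_of_lt_of_le (htr i).1 (hpre'.trans hpre'').length_le
          have h2 : K'' (tr i) = insert i T := by
            rw [hagr'' _ (lt_of_lt_of_le (htr i).1 hpre'.length_le), hagr' _ (htr i).1,
              (htr i).2.1]
          have h3 : (ArithCircuit.gateValues L'').getD (tr i) 0 = R i := by
            rw [rowScanGates_getD_eq_of_prefix (hpre'.trans hpre'') (htr i).1, (htr i).2.2]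
          obtain ⟨L₄, K₄, hp, ha, hl, hI, t, ht, hK, hv⟩ := blockGadgets_opPow A w Inv hhered
            (insert i (S ∪ T)) (hinsST i) (.gate (tr i)) ((k : ℕ) + 1) (by omega) L'' K'' h1
            (by
              simp only [SupportSymm.osupp]
              rw [h2]
              exact Finset.insert_subset_insert i Finset.subset_union_right) hInv''
          refine ⟨L₄, K₄, hp, ha, hl, hI, fun _ => ⟨t, ht, hK, ?_⟩⟩
          rw [hv, ArithCircuit.Operand.eval_gate, h3])
        hInv'
      choose tab htab using fun i => hpow i ()
      obtain ⟨L₄, K₄, hp, ha, hl, hI, t, ht, hK, hv⟩ := blockGadgets_equivSum A w Inv hcore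
        (by omega) (S ∪ T) hSTw (fun i => R i ^ ((k : ℕ) + 1))
        (fun σ hσ i => by rw [map_pow, hequiv σ hσ i]) L₃ K₃ tab
        (fun i => ⟨(htab i).1, (htab i).2.2⟩) hInv₃
      refine ⟨L₄, K₄, hpre₃.trans hp, fun t ht => ?_, ?_, hI, fun _ => ⟨t, ht, hK, hv⟩⟩
      · rw [ha t (lt_of_lt_of_le ht hpre₃.length_le), hagr₃ t ht]
      · rw [Fintype.card_fin] at hlen₃
        omega)
    hInv₁
  choose ps hps' using fun k : Fin n => hps k ()
  -- Step 3: Newton's recursion at support `S ∪ T`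
  have hpsum : ∀ k : ℕ, aeval R (psum (Fin n) ℂ (k + 1)) = ∑ i : Fin n, R i ^ (k + 1) := by
    intro k
    simp only [psum, map_sum, map_pow, aeval_X]
  have key := blockGadgets_newton A w Inv hhered n hAn (S ∪ T) hSTw
    (fun k => aeval R (esymm (Fin n) ℂ k)) (fun k => ∑ i : Fin n, R i ^ (k + 1))
    (by simp) ?_ L₂ K₂ (fun k => if h : k < n then ps ⟨k, h⟩ else 0) ?_ hInv₂
  · obtain ⟨L', K', hpre, hagr, hlen, hInv', t, ht, hK, hv⟩ := key
    refine ⟨L', K', (hpre₁.trans hpre₂).trans hpre, fun t ht => ?_, ?_, hInv', t, ht, hK, ?_⟩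
    · rw [hagr t (lt_of_lt_of_le ht (hpre₁.trans hpre₂).length_le),
        hagr₂ t (lt_of_lt_of_le ht hpre₁.length_le), hagr₁ t ht]
    · rw [Fintype.card_fin] at hlen₁ hlen₂
      have h3 : 3 * (n + 1) ^ 3 = 3 * (n + 1) * (n + 1) * (n + 1) := by ring
      nlinarith [hlen, hlen₁, hlen₂, h3]
    · rw [hv, NewtonProdPsum.esymm_self_eq_prod_X, map_prod, monomial_eq, C_1, one_mul,
        Finsupp.prod_fintype _ _ (fun _ => pow_zero _), Fintype.prod_prod_type]
      exact Finset.prod_congr rfl fun i _ => by rw [aeval_X, hR]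
  · -- Newton's identities pushed through `aeval R`
    intro k _
    have h := congrArg (aeval R)
      (CommutingMatricesNewton.natCast_mul_esymm_eq_sum_range (Fin n) ℂ k)
    rw [map_mul, map_natCast, map_sum] at h
    rw [h]
    refine Finset.sum_congr rfl fun i' _ => ?_
    rw [map_mul, map_mul, map_pow, map_neg, map_one, hpsum]
  · -- the located power sums
    intro k hk
    have h := hps' ⟨k, hk⟩
    simp only [dif_pos hk]
    exact h

end Blocks

/-! ### Registered sub-goal -/

/-- **Block monomials (registered sub-goal, closed form of `blockGadgets_monomial`).** For every
invariant `Inv` of annotated gate lists closed under the two extension rules (fan-in `≤ A`,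
support width `≤ w`): a block monomial `x^a` (entries `≤ D`, special rows `S`, special columns
`T`, `|S ∪ T| + 1 ≤ w`, `2 ≤ w`, `A ≥ n + 2, D n + 1`) is located at support `S ∪ T` by at most
`3 (n + 1)³` more gates. [cite: Macdonald1995, I.(2.11')] -/
theorem blockGadgets_monomial_located : ∀ (n A w : ℕ)
    (Inv : List (Literature.Computability.AlgebraicComplexity.ArithCircuit.Gate ℂ (Fin n × Fin n)) →
      (ℕ → Finset (Fin n)) → Prop),
    (∀ (L : List (Literature.Computability.AlgebraicComplexity.ArithCircuit.Gate ℂ (Fin n × Fin n)))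
      (K : ℕ → Finset (Fin n))
      (g : Literature.Computability.AlgebraicComplexity.ArithCircuit.Gate ℂ (Fin n × Fin n))
      (S : Finset (Fin n)), Inv L K → g.args ≠ [] → g.fanIn ≤ A →
      (∀ u ∈ g.args, u.RefsBelow L.length) → S.card ≤ w →
      (∀ us, g = .prod us → ∀ u ∈ us,
        Literature.Computability.AlgebraicComplexity.SupportSymm.osupp K u ⊆ S) →
      (∀ σ : Equiv.Perm (Fin n), (∀ x ∈ S, σ x = x) →
        MvPolynomial.rename (fun pq : Fin n × Fin n => (σ pq.1, σ pq.2))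
          (g.eval (Literature.Computability.AlgebraicComplexity.ArithCircuit.gateValues L)) =
          g.eval (Literature.Computability.AlgebraicComplexity.ArithCircuit.gateValues L)) →
      Inv (L ++ [g]) (Function.update K L.length S)) →
    (∀ (L : List (Literature.Computability.AlgebraicComplexity.ArithCircuit.Gate ℂ (Fin n × Fin n)))
      (K : ℕ → Finset (Fin n))
      (g : Literature.Computability.AlgebraicComplexity.ArithCircuit.Gate ℂ (Fin n × Fin n))
      (S : Finset (Fin n)), Inv L K → g.args ≠ [] → g.fanIn ≤ A →
      (∀ u ∈ g.args, u.RefsBelow L.length) → S.card ≤ w →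
      (∀ u ∈ g.args, Literature.Computability.AlgebraicComplexity.SupportSymm.osupp K u ⊆ S) →
      Inv (L ++ [g]) (Function.update K L.length S)) →
    ∀ (D : ℕ), n + 2 ≤ A → D * n + 1 ≤ A → 2 ≤ w →
    ∀ (a : (Fin n × Fin n) →₀ ℕ), (∀ p, a p ≤ D) → ∀ (S T : Finset (Fin n)), (S ∪ T).card + 1 ≤ w →
    (∀ i i' j : Fin n, i ∉ S → i' ∉ S → a (i, j) = a (i', j)) →
    (∀ i j j' : Fin n, j ∉ T → j' ∉ T → a (i, j) = a (i, j')) →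
    ∀ (L : List (Literature.Computability.AlgebraicComplexity.ArithCircuit.Gate ℂ (Fin n × Fin n)))
      (K : ℕ → Finset (Fin n)), Inv L K →
    ∃ (L' : List (Literature.Computability.AlgebraicComplexity.ArithCircuit.Gate ℂ (Fin n × Fin n)))
      (K' : ℕ → Finset (Fin n)), L <+: L' ∧ (∀ t < L.length, K' t = K t) ∧
      L'.length ≤ L.length + 3 * (n + 1) ^ 3 ∧ Inv L' K' ∧
      ∃ t < L'.length, K' t = S ∪ T ∧
        (Literature.Computability.AlgebraicComplexity.ArithCircuit.gateValues L').getD t 0 =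
          MvPolynomial.monomial a 1 :=
  fun _ A w Inv hcore hhered => blockGadgets_monomial A w Inv hcore hhered

end Summit.ValiantsHypothesis.ValiantsHypothesis.Theorems
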